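import Literature.Analysis.Complex.LogDerivZerosDisc
import Literature.Analysis.Complex.BacklundJensenAverage
import Mathlib.Analysis.Complex.ExponentialBounds
import HarnessLib

/-!
# The Landau–Titchmarsh bound for `f'/f` on a horizontal segment separated from the zeros

For `f` holomorphic on a neighbourhood of the closed disc `‖w - c‖ ≤ 2R` with `‖f‖ ≤ M` there and
`f(c) ≠ 0`, such that every zero `a` of `f` with `‖a - c‖ ≤ R` satisfies `|Im a - Im c| ≥ η > 0`,
and for `z` on the horizontal line through `c` with `‖z - c‖ ≤ R/4`:

  `‖f'/f (z)‖ ≤ 16 (log (M / ‖f c‖) + 1) (1/η + 1/R)`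

(`norm_logDeriv_le_of_zeros_im_separated_of_norm_le`). This is the shape of Titchmarsh 1986, §3.9
Lemma α (`f'/f(z) = Σ_{‖ρ-c‖≤R} m(ρ)/(z-ρ) + O(log(M/|f(c)|)/R)`) consumed on the horizontal
sides of explicit-formula rectangles: each `|z - ρ| ≥ |Im z - Im ρ| ≥ η`, and
`Σ m(ρ) ≤ log(M/|f(c)|)/log 2` by Jensen. Proof: normalise to `‖g‖ ≤ 1` (`g = f/M`; `f'/f`,
the zeros and `M/‖f(c)‖ = 1/‖g(c)‖` are unchanged); Landau's lemma
`Literature.Analysis.Complex.norm_logDeriv_sub_sum_le` with the radii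
`R/4 < R/2 < R < 2R` gives `‖g'/g(z) - Σ_ρ m(ρ)/(z - ρ)‖ ≤ (8/R)(L + N log 2 + 1)`,
`L = log(1/‖g(c)‖)`, `N = Σ m(ρ)` over the zeros in `‖ρ - c‖ ≤ R`; the sum is at most `N/η`; and
`N log 2 ≤ L` by Jensen's inequality in the mean form
`Literature.Analysis.Complex.sum_divisor_le_of_circleAverage_le`. Since `log 2 > 1/2`, `N ≤ 2L` and
the total is `≤ 16 (L + 1)(1/η + 1/R)`.

This is the topical home of the statement formerly vended as the named fact
`Literature.Uncategorized.HorizontalLogDerivBound` (gate relocation from a Summits proposal,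
2026-08-16; entire `f`, `z = x + i Im c`, `∃ K`); that name, its discharge
`Literature.Uncategorized.HorizontalLogDerivBound_holds` and the normalised lemma
`Literature.Uncategorized.norm_logDeriv_le_of_zeros_im_separated` are kept there as one-line
consequences of the theorem below (librarian refactor wi-35550).

## References
* E. C. Titchmarsh, *The Theory of the Riemann Zeta-Function*, 2nd ed. (1986), §3.9 Lemma α.
  [Titchmarsh1986]
-/

noncomputable section

namespace Literature.Analysis.Complex

open Set Metric MeromorphicOn

/-- Normalised form (`‖g‖ ≤ 1` on the big disc) of
`norm_logDeriv_le_of_zeros_im_separated_of_norm_le`; the general statement below is this one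
applied to `g = f / M`.
**Landau–Titchmarsh on a horizontal segment, normalised form.** Let `g` be holomorphic on
`‖w - c‖ ≤ 2R` with `‖g‖ ≤ 1` there and `g(c) ≠ 0`, and suppose every zero `a` of `g` with
`‖a - c‖ ≤ R` satisfies `|Im a - Im c| ≥ η > 0`. Then for `z` with `Im z = Im c` and
`‖z - c‖ ≤ R/4`,
`‖g'/g(z)‖ ≤ 16 (log(1/‖g(c)‖) + 1)(1/η + 1/R)` (Titchmarsh §3.9 Lemma α:
`g'/g(z) = Σ_{‖ρ-c‖≤R} m(ρ)/(z-ρ) + O((L + N log 2 + 1)/R)` with each `|z - ρ| ≥ η` and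
`N log 2 ≤ L = log(1/‖g(c)‖)` by Jensen). [cite: Titchmarsh1986, §3.9 Lemma α] -/
private theorem norm_logDeriv_le_of_zeros_im_separated_one {g : ℂ → ℂ} {c z : ℂ} {R η : ℝ}
    (hR : 0 < R) (hη : 0 < η) (hg : AnalyticOnNhd ℂ g (closedBall c (2 * R))) (hc : g c ≠ 0)
    (h1 : ∀ w ∈ closedBall c (2 * R), ‖g w‖ ≤ 1)
    (hsep : ∀ a : ℂ, g a = 0 → ‖a - c‖ ≤ R → η ≤ |a.im - c.im|)
    (hz : ‖z - c‖ ≤ R / 4) (hzim : z.im = c.im) :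
    ‖logDeriv g z‖ ≤ 16 * (Real.log (1 / ‖g c‖) + 1) * (1 / η + 1 / R) := by
  classical
  have hgc : 0 < ‖g c‖ := norm_pos_iff.2 hc
  have hgc1 : ‖g c‖ ≤ 1 := h1 c (mem_closedBall_self (by positivity))
  have hlog2 : (1 : ℝ) / 2 < Real.log 2 := by
    have := Real.log_two_gt_d9
    linarith
  have hlog2pos : 0 < Real.log 2 := by linarith
  -- `z` is not a zero of `g`
  have hgz : g z ≠ 0 := by
    intro h0
    have := hsep z h0 (by linarith)
    rw [hzim, sub_self, abs_zero] at this
    linarith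
  have hzmem : z ∈ closedBall c (R / 4) := by rwa [mem_closedBall, dist_eq_norm]
  have hgR : AnalyticOnNhd ℂ g (closedBall c R) :=
    hg.mono (closedBall_subset_closedBall (by linarith))
  -- Landau's lemma (Titchmarsh §3.9 Lemma α) with radii `R/4 < R/2 < R < 2R` and `B = 1`
  have main := Literature.Analysis.Complex.norm_logDeriv_sub_sum_le (f := g) (c := c)
    (r := R / 4) (r₁ := R / 2) (R₂ := R) (R := 2 * R) (B := 1)
    (by positivity) (by linarith) (by linarith) (by linarith) hg hc h1 hzmem hgz
  -- Jensen's inequality, mean form, on the discs of radii `R < 2R`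
  have h2R : |2 * R| = 2 * R := abs_of_pos (by positivity)
  have hsph : sphere c |2 * R| ⊆ closedBall c (2 * R) := by
    rw [h2R]
    exact sphere_subset_closedBall
  have hint : CircleIntegrable (fun w ↦ Real.log ‖g w‖) c (2 * R) :=
    (hg.mono hsph).meromorphicOn.circleIntegrable_log_norm
  have hA : Real.circleAverage (fun w ↦ Real.log ‖g w‖) c (2 * R) ≤ 0 :=
    Real.circleAverage_mono_on_of_le_circle hint fun w hw ↦
      Real.log_nonpos (norm_nonneg _) (h1 w (hsph hw))
  have hJ := Literature.Analysis.Complex.sum_divisor_le_of_circleAverage_le (r := R) (R := 2 * R)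
    hR (by linarith) hg hc hA
  -- notation
  set D := divisor g (closedBall c R) with hD
  set S := (D.finiteSupport (isCompact_closedBall c R)).toFinset with hS
  set N : ℝ := ∑ u ∈ S, (D u : ℝ) with hN
  set L : ℝ := Real.log (1 / ‖g c‖) with hL
  have hL' : L = -Real.log ‖g c‖ := by rw [hL, one_div, Real.log_inv]
  have hL0 : 0 ≤ L := by
    rw [hL]
    exact Real.log_nonneg ((one_le_div hgc).2 hgc1)
  have hD0i : ∀ u, (0 : ℤ) ≤ D u := fun u ↦ hgR.divisor_nonneg u
  have hD0 : ∀ u, (0 : ℝ) ≤ (D u : ℝ) := fun u ↦ by exact_mod_cast hD0i u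
  -- the constants in Landau's lemma
  have hcoef : 2 * (R / 2) / ((R - R / 2) * (R / 2 - R / 4)) = 8 * (1 / R) := by
    field_simp
    ring
  have hlogtwo : Real.log (2 * R / (2 * R - R)) = Real.log 2 := by
    congr 1
    field_simp
    ring
  rw [hcoef, hlogtwo] at main
  -- members of `S` are zeros of `g` in the disc of radius `R`
  have hSmem : ∀ u ∈ S, g u = 0 ∧ ‖u - c‖ ≤ R := by
    intro u hu
    rw [hS, Set.Finite.mem_toFinset, Function.mem_support] at hu
    have huU : u ∈ closedBall c R := D.supportWithinDomain hu
    refine ⟨?_, by rwa [mem_closedBall, dist_eq_norm] at huU⟩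
    by_contra hne
    apply hu
    rw [hD, hgR.divisor_apply huU, ((hgR u huU).analyticOrderAt_eq_zero).2 hne]
    rfl
  -- the sum over the zeros: each term has modulus `≤ m(ρ)/η`
  have hsum : ‖∑ u ∈ S, (D u : ℂ) / (z - u)‖ ≤ N * (1 / η) := by
    rw [hN, Finset.sum_mul]
    refine (norm_sum_le _ _).trans (Finset.sum_le_sum fun u hu ↦ ?_)
    obtain ⟨hgu, huc⟩ := hSmem u hu
    have hzu : η ≤ ‖z - u‖ := by
      refine (hsep u hgu huc).trans (le_trans (le_of_eq ?_) (Complex.abs_im_le_norm (z - u)))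
      rw [Complex.sub_im, hzim, abs_sub_comm]
    rw [norm_div, Complex.norm_intCast, abs_of_nonneg (hD0 u), mul_one_div]
    exact div_le_div_of_nonneg_left (hD0 u) hη hzu
  -- Jensen: `N log 2 ≤ L`
  have hNL : N * Real.log 2 ≤ L := by
    have h2 : 2 * R / R = 2 := by field_simp
    rw [h2, zero_sub, ← hL'] at hJ
    have hfs : (∑ᶠ u, D u) = ∑ u ∈ S, D u :=
      finsum_eq_sum_of_support_subset _ fun u hu ↦ by
        rw [hS, Finset.mem_coe, Set.Finite.mem_toFinset]
        exact hu
    have hcast : ((∑ᶠ u, D u : ℤ) : ℝ) = N := by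
      rw [hfs, hN]
      push_cast
      rfl
    have hN' : N ≤ L / Real.log 2 := hcast ▸ hJ
    rwa [le_div_iff₀ hlog2pos] at hN'
  have hN2L : N ≤ 2 * L := by nlinarith
  -- assemble
  have htri := norm_sub_norm_le (logDeriv g z) (∑ u ∈ S, (D u : ℂ) / (z - u))
  have hρ : 0 < 1 / R := by positivity
  have hθ : 0 < 1 / η := by positivity
  have e1 : 0 ≤ (1 / η) * (16 * L - N) := mul_nonneg hθ.le (by linarith)
  have e2 : 0 ≤ (1 / R) * (L - N * Real.log 2) := mul_nonneg hρ.le (by linarith)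
  have e3 : 0 ≤ (1 / R) * L := mul_nonneg hρ.le hL0
  nlinarith [main, hsum, htri, e1, e2, e3, hρ, hθ]

/-- **Landau–Titchmarsh on a horizontal segment.** Let `f` be holomorphic on a neighbourhood of
`‖w - c‖ ≤ 2R` with `‖f‖ ≤ M` there and `f(c) ≠ 0`, and suppose every zero `a` of `f` with
`‖a - c‖ ≤ R` satisfies `|Im a - Im c| ≥ η > 0`. Then for `z` with `Im z = Im c` and
`‖z - c‖ ≤ R/4`,
`‖f'/f(z)‖ ≤ 16 (log(M/‖f(c)‖) + 1)(1/η + 1/R)` (Titchmarsh §3.9 Lemma α with each `|z - ρ| ≥ η`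
and `N log 2 ≤ log(M/‖f(c)‖)` by Jensen; the normalised case `M = 1` applied to `f/M`).
[cite: Titchmarsh1986, §3.9 Lemma α] -/
theorem norm_logDeriv_le_of_zeros_im_separated_of_norm_le {f : ℂ → ℂ} {c z : ℂ} {R η M : ℝ}
    (hR : 0 < R) (hη : 0 < η) (hf : AnalyticOnNhd ℂ f (closedBall c (2 * R))) (hc : f c ≠ 0)
    (hM : ∀ w ∈ closedBall c (2 * R), ‖f w‖ ≤ M)
    (hsep : ∀ a : ℂ, f a = 0 → ‖a - c‖ ≤ R → η ≤ |a.im - c.im|)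
    (hz : ‖z - c‖ ≤ R / 4) (hzim : z.im = c.im) :
    ‖logDeriv f z‖ ≤ 16 * (Real.log (M / ‖f c‖) + 1) * (1 / η + 1 / R) := by
  have hfc : 0 < ‖f c‖ := norm_pos_iff.2 hc
  have hMc : ‖f c‖ ≤ M := hM c (mem_closedBall_self (by positivity))
  have hM0 : 0 < M := hfc.trans_le hMc
  have hMC : (M : ℂ) ≠ 0 := by exact_mod_cast hM0.ne'
  -- the normalised function `g = f / M`
  set g : ℂ → ℂ := fun w ↦ (M : ℂ)⁻¹ * f w with hg
  have hg_an : AnalyticOnNhd ℂ g (closedBall c (2 * R)) := fun w hw ↦ by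
    rw [hg]
    exact analyticAt_const.mul (hf w hw)
  have hg0 : ∀ w, g w = 0 → f w = 0 := fun w hw ↦ by
    rw [hg] at hw
    simpa [hMC] using hw
  have hgc : g c ≠ 0 := fun h ↦ hc (hg0 c h)
  have hnorm : ∀ w, ‖g w‖ = M⁻¹ * ‖f w‖ := fun w ↦ by
    simp only [hg, norm_mul, norm_inv, Complex.norm_real, Real.norm_eq_abs, abs_of_pos hM0]
  have h1 : ∀ w ∈ closedBall c (2 * R), ‖g w‖ ≤ 1 := fun w hw ↦ by
    rw [hnorm, inv_mul_le_iff₀ hM0, mul_one]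
    exact hM w hw
  have hsep' : ∀ a : ℂ, g a = 0 → ‖a - c‖ ≤ R → η ≤ |a.im - c.im| := fun a ha ↦
    hsep a (hg0 a ha)
  have key := norm_logDeriv_le_of_zeros_im_separated_one hR hη hg_an hgc h1 hsep' hz hzim
  -- back to `f`
  have hld : logDeriv g z = logDeriv f z := by
    rw [hg]
    exact logDeriv_const_mul _ _ (inv_ne_zero hMC)
  have hlog : Real.log (1 / ‖g c‖) = Real.log (M / ‖f c‖) := by
    rw [hnorm c, one_div, mul_inv, inv_inv, ← div_eq_mul_inv]
  rw [hld, hlog] at key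
  exact key

/-- The entire-function form with the point written as `x + i Im c`, `|x - Re c| ≤ R/4` (the shape
of `Literature.Uncategorized.HorizontalLogDerivBound`, constant `K = 16`).
[cite: Titchmarsh1986, §3.9 Lemma α] -/
theorem norm_logDeriv_ofReal_add_mul_I_le_of_zeros_im_separated {f : ℂ → ℂ}
    (hf : Differentiable ℂ f)
    {c : ℂ} {R η M : ℝ} (hR : 0 < R) (hη : 0 < η) (hc : f c ≠ 0)
    (hM : ∀ w ∈ closedBall c (2 * R), ‖f w‖ ≤ M)
    (hsep : ∀ a : ℂ, f a = 0 → ‖a - c‖ ≤ R → η ≤ |a.im - c.im|) {x : ℝ} (hx : |x - c.re| ≤ R / 4) :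
    ‖logDeriv f (x + c.im * Complex.I)‖ ≤ 16 * (Real.log (M / ‖f c‖) + 1) * (1 / η + 1 / R) := by
  have hzc : (x : ℂ) + c.im * Complex.I - c = ((x - c.re : ℝ) : ℂ) := by
    apply Complex.ext <;> simp
  have hz : ‖(x : ℂ) + c.im * Complex.I - c‖ ≤ R / 4 := by
    rw [hzc, Complex.norm_real, Real.norm_eq_abs]
    exact hx
  have hzim : ((x : ℂ) + c.im * Complex.I).im = c.im := by simp
  exact norm_logDeriv_le_of_zeros_im_separated_of_norm_le hR hη (fun w _ ↦ hf.analyticAt w) hc hM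
    hsep hz hzim

end Literature.Analysis.Complex

end
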